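import Summits.QuantumFields.BalabanUV.Beta.D1BFx.RoadEndBFxRecut

/-!
# Road BF-x, END-TO-END OVER THE RE-CUT REST TABLE, GHOST SECTOR ON ITS WARD RAY: `hrowgh` is no longer a hypothesis

Owner file of road «BF-x» (BINDER-OWNERS row D1, co-owner d1-p2, gen 3).  The RAY twin of `RoadEndBFxRecut.d1Drift_BFx_recut` (p224363): the ghost
weights are PINNED to the Ward ray of leaf-02-g2's completed ghost triple (`GhostKernelComplete`, T7-gh v1.2): `(x₀, cK, cQ) := (−cgh n, cgh n·n², cgh n·a)`
for a free real weight family `cgh`; on that ray the ghost Ward rows `∀ κ′ λ′ b, HasSum (fineHessGhQ n a x₀ cK cQ κ′ λ′ b) 0` are the THEOREM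
`GhostKernelComplete.hasSum_row_fineHessGhQ_ray` (`0 < a`, every real weight), so `hrowgh` disappears from the road's displayed debt.  The kinetic∕Q
weights `cK`, `cQ` are SHARED with the gauge-term sector of the gluon stencil (`SbfBal … cK cQ`, J5's `Rdot`), so the pin is displayed there too; the
loop-weight ratio reads `ω_gh·(cgh·n²)² = −2·ω_gl·cE²`.  Whether Bałaban's ghost weights lie on this ray is a CHECK-N0 (units) question, asserted
nowhere: this is a VARIANT of the END of record, not a replacement.

HONEST STATUS: composition [folklore]; no cited facts; D1 NOT discharged — B1, (K), `Spr (Ga n a)`, the slot-table sockets, `hdiv`, the far rows of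
`gfrz`, (REST′) and (U) remain OPEN hypotheses.  HONEST DEPENDENCY: continuum YM on T⁴ ⇐ BetaPertH ∧ nine spine estimates (0/9 proved); BetaPertH ⇐
(D1) ∧ (D4) ∧ CAP+tail; G-an2-4 gates asym, D1 and NE2/3/4.
-/

noncomputable section

open Finset Filter Topology
open scoped BigOperators
open Literature.MathematicalPhysics.QuantumFieldTheory.Balaban1983to89
open Literature.MathematicalPhysics.QuantumFieldTheory.Balaban1983to89.Beta
open OneStepResolventKernel (JetData)
open OneStepKernelFamily (TbalOf D1Drift)
open WindowIdentification (fullSum)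
open DyadicShell (Pt supNorm)
open ExpKernelCalculus (Site BiLoc shiftK)
open GhostTable (gFree)
open BubbleTransfer (unitVec)
open DressedMomentNormalisation (resSite)
open Summit.QuantumFields.BalabanUV.Beta.TameKernelCalculus (Spr)
open Summit.QuantumFields.BalabanUV.Beta.D1BFx.GluonLeg (Ga)
open Summit.QuantumFields.BalabanUV.Beta.D1BFx.ReducedKernel (TableR TOfRed)
open Summit.QuantumFields.BalabanUV.Beta.D1BFx.DressedTadpoleTable (tableRed)
open Summit.QuantumFields.BalabanUV.Beta.D1BFx.ReducedKernelSandwich (fineHess)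
open Summit.QuantumFields.BalabanUV.Beta.D1BFx.FineStencilBFBalaban (SbfBal)
open Summit.QuantumFields.BalabanUV.Beta.D1BFx.SecondStencilBF (Wbf)
open Summit.QuantumFields.BalabanUV.Beta.D1BFx.GhostKernelComplete (PghQ fineHessGhQ hasSum_row_fineHessGhQ_ray)
open Summit.QuantumFields.BalabanUV.Beta.D1BFx.FrozenLegProfile (gfrz)
open Summit.QuantumFields.BalabanUV.Beta.D1BFx.SplitInstance (RestIdx)
open Summit.QuantumFields.BalabanUV.Beta.D1BFx.SplitRecut (restK')
open Summit.QuantumFields.BalabanUV.Beta.D1BFx.RoadEndBFxRecut (cornerIdx d1Drift_BFx_recut)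

namespace Summit.QuantumFields.BalabanUV.Beta.D1BFx.RoadEndBFxRecutRay

variable {Lc : ℕ} [NeZero Lc] {a N : ℝ} {μ ν : Fin 4} {υ : Type*} [Fintype υ]
  {cE cVH cΛ cR cgh cE₂ cJ4 cΛ₂ cR₂ cQ₂ ωgl ωgh : ℕ → ℝ} {WE WJ WΛ WR WQ : ℕ → TableR} {CE CJ CΛ CRt CQ δW : ℕ → ℝ}
  {Ru : υ → ℕ → ℝ} {CU : υ → ℝ} {CR : RestIdx → ℝ} {A : ℕ → ℝ} {D₂ δ U₁ : ℝ}

/-- [folklore] **ROAD BF-x, END TO END, RE-CUT TABLE, GHOST WEIGHTS ON THE WARD RAY** `(x₀, cK, cQ) := (−cgh n, cgh n·n², cgh n·a)`: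
`RoadEndBFxRecut.d1Drift_BFx_recut` with `hrowgh` DISCHARGED by `GhostKernelComplete.hasSum_row_fineHessGhQ_ray`; every other hypothesis displayed
verbatim at the pinned ghost weights. -/
theorem d1Drift_BFx_recut_ray (Js : ℕ → JetData 3 Lc) (hμν : μ ≠ ν) (hN : N ≠ 0) (hL : 2 ≤ Lc) (hodd : Odd Lc) (ha : 0 < a) (c : ℕ → ℝ)
    (hD₂ : 0 ≤ D₂) (hA : ∀ j, 0 ≤ A j) (hδ : 0 < δ)
    -- the frozen profile's FAR rows (B5 Prop. 1.2 content)
    (h2 : ∀ n : ℕ, 2 ≤ n → ∀ [NeZero n], ∀ b ∈ (univ : Finset (Fin 4 → Fin n)).image resSite, ∀ v,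
      |(gfrz n a b (v + unitVec ν + unitVec μ) - gFree (v + unitVec ν + unitVec μ)) - (gfrz n a b (v + unitVec ν) - gFree (v + unitVec ν)) -
          (gfrz n a b (v + unitVec μ) - gFree (v + unitVec μ)) + (gfrz n a b v - gFree v)| ≤ D₂ / (n : ℝ) ^ 4)
    (d0 : ∀ n : ℕ, 2 ≤ n → ∀ [NeZero n], ∀ b ∈ (univ : Finset (Fin 4 → Fin n)).image resSite, ∀ v : Pt, v ≠ 0 →
      |gfrz n a b v| ≤ A 0 * Real.exp (-(δ / n) * supNorm v) / (supNorm v : ℝ) ^ 2)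
    (d1 : ∀ n : ℕ, 2 ≤ n → ∀ [NeZero n], ∀ b ∈ (univ : Finset (Fin 4 → Fin n)).image resSite, ∀ v : Pt, v ≠ 0 → ∀ ρ : Fin 4,
      |gfrz n a b (v + unitVec ρ) - gfrz n a b v| ≤ A 1 * Real.exp (-(δ / n) * supNorm v) / (supNorm v : ℝ) ^ 3)
    (d2 : ∀ n : ℕ, 2 ≤ n → ∀ [NeZero n], ∀ b ∈ (univ : Finset (Fin 4 → Fin n)).image resSite, ∀ v : Pt, v ≠ 0 →
      |gfrz n a b (v + unitVec ν + unitVec μ) - gfrz n a b (v + unitVec ν) - gfrz n a b (v + unitVec μ) + gfrz n a b v| ≤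
        A 2 * Real.exp (-(δ / n) * supNorm v) / (supNorm v : ℝ) ^ 4)
    -- bridge B1
    (hB1 : ∀ m : ℕ, 1 ≤ m → |(∑ j ∈ range m, B12Beta.secondMoment (TbalOf Lc Js j) μ ν) - c (Lc ^ m)| ≤ U₁)
    -- the (α)-leaf and slot (K) with the loop-weight ratio and the PINNED normalisation
    (hGa : ∀ n : ℕ, 2 ≤ n → ∀ [NeZero n], Spr (Ga n a))
    (hK : ∀ n : ℕ, 2 ≤ n → Odd n → ∀ [NeZero n], c n =
      ωgl n * B12Beta.secondMoment (TOfRed n a (SbfBal n a (cE n) (cVH n) (cΛ n) (cR n) (cgh n * (n : ℝ) ^ 2) (cgh n * a))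
        (tableRed n (Wbf (cE₂ n) (cJ4 n) (cΛ₂ n) (cR₂ n) (cQ₂ n) (WE n) (WJ n) (WΛ n) (WR n) (WQ n)))) μ ν
      + ωgh n * B12Beta.secondMoment (PghQ n a (-cgh n) (cgh n * (n : ℝ) ^ 2) (cgh n * a)) μ ν + ∑ u, Ru u n)
    (hω : ∀ n : ℕ, 2 ≤ n → ωgh n * (cgh n * (n : ℝ) ^ 2) ^ 2 = -2 * (ωgl n * cE n ^ 2)) (hlam : ∀ n : ℕ, 2 ≤ n → ωgl n * cE n ^ 2 = 2 * N ^ 2 * (n : ℝ) ^ 8)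
    -- slot-table sockets
    (hδW : ∀ n, 0 < δW n)
    (hE : ∀ n κ u l u', BiLoc (WE n κ u l u') u u' (CE n) (δW n)) (hJ : ∀ n κ u l u', BiLoc (WJ n κ u l u') u u' (CJ n) (δW n))
    (hΛ : ∀ n κ u l u', BiLoc (WΛ n κ u l u') u u' (CΛ n) (δW n)) (hR : ∀ n κ u l u', BiLoc (WR n κ u l u') u u' (CRt n) (δW n))
    (hQ : ∀ n κ u l u', BiLoc (WQ n κ u l u') u u' (CQ n) (δW n))
    (hEc : ∀ (n : ℕ) (κ : Fin 4) (u : Site 4) (l : Fin 4) (u' t : Site 4),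
      WE n κ (u + (n : ℤ) • t) l (u' + (n : ℤ) • t) = shiftK (-((n : ℤ) • t)) (WE n κ u l u'))
    (hJc : ∀ (n : ℕ) (κ : Fin 4) (u : Site 4) (l : Fin 4) (u' t : Site 4),
      WJ n κ (u + (n : ℤ) • t) l (u' + (n : ℤ) • t) = shiftK (-((n : ℤ) • t)) (WJ n κ u l u'))
    (hΛc : ∀ (n : ℕ) (κ : Fin 4) (u : Site 4) (l : Fin 4) (u' t : Site 4),
      WΛ n κ (u + (n : ℤ) • t) l (u' + (n : ℤ) • t) = shiftK (-((n : ℤ) • t)) (WΛ n κ u l u'))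
    (hRc : ∀ (n : ℕ) (κ : Fin 4) (u : Site 4) (l : Fin 4) (u' t : Site 4),
      WR n κ (u + (n : ℤ) • t) l (u' + (n : ℤ) • t) = shiftK (-((n : ℤ) • t)) (WR n κ u l u'))
    (hQc : ∀ (n : ℕ) (κ : Fin 4) (u : Site 4) (l : Fin 4) (u' t : Site 4),
      WQ n κ (u + (n : ℤ) • t) l (u' + (n : ℤ) • t) = shiftK (-((n : ℤ) • t)) (WQ n κ u l u'))
    (hEs : ∀ n κ u l u', WE n κ u l u' = WE n l u' κ u) (hJs : ∀ n κ u l u', WJ n κ u l u' = WJ n l u' κ u)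
    (hΛs : ∀ n κ u l u', WΛ n κ u l u' = WΛ n l u' κ u) (hRs : ∀ n κ u l u', WR n κ u l u' = WR n l u' κ u)
    (hQs : ∀ n κ u l u', WQ n κ u l u' = WQ n l u' κ u)
    -- first-bond divergence-freeness of the gluon fine Hessian kernel (the ghost Ward rows are a THEOREM on the ray)
    (hdiv : ∀ n : ℕ, 2 ≤ n → ∀ [NeZero n], ∀ (l' : Fin 4) (u' u : Site 4), ∑ κ' : Fin 4,
      (fineHess n a (SbfBal n a (cE n) (cVH n) (cΛ n) (cR n) (cgh n * (n : ℝ) ^ 2) (cgh n * a))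
          (Wbf (cE₂ n) (cJ4 n) (cΛ₂ n) (cR₂ n) (cQ₂ n) (WE n) (WJ n) (WΛ n) (WR n) (WQ n)) κ' l' (u - Pi.single κ' 1) u'
        - fineHess n a (SbfBal n a (cE n) (cVH n) (cΛ n) (cR n) (cgh n * (n : ℝ) ^ 2) (cgh n * a))
          (Wbf (cE₂ n) (cJ4 n) (cΛ₂ n) (cR₂ n) (cQ₂ n) (WE n) (WJ n) (WΛ n) (WR n) (WQ n)) κ' l' u u') = 0)
    -- (REST′) for the re-cut words other than the corner, n-UNIFORM; (U)
    (hRest : ∀ n : ℕ, 2 ≤ n → ∀ [NeZero n], ∀ τ : RestIdx, τ ≠ cornerIdx →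
      |∑ b ∈ (univ : Finset (Fin 4 → Fin n)).image resSite, ((n : ℝ) ^ 4)⁻¹ *
        fullSum (fun w : Pt => restK' n a (gfrz n a b) (cE n) (cΛ n) (cR n) (cgh n * (n : ℝ) ^ 2) (cgh n * a) (cE₂ n) (cJ4 n) (cΛ₂ n) (cR₂ n)
          (cQ₂ n) (-cgh n) (WE n) (WJ n) (WΛ n) (WR n) (WQ n) (ωgl n) (ωgh n) ((n : ℝ) ^ 8) N μ ν b τ w)| ≤ CR τ)
    (hU : ∀ n : ℕ, 2 ≤ n → ∀ u, |Ru u n| ≤ CU u) :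
    D1Drift Lc Js N μ ν :=
  d1Drift_BFx_recut (x₀ := fun n => -cgh n) (cK := fun n => cgh n * (n : ℝ) ^ 2) (cQ := fun n => cgh n * a) Js hμν hN hL hodd ha c hD₂ hA hδ h2
    d0 d1 d2 hB1 hGa hK hω hlam hδW hE hJ hΛ hR hQ hEc hJc hΛc hRc hQc hEs hJs hΛs hRs hQs hdiv
    (fun n _ _ κ' l' b => hasSum_row_fineHessGhQ_ray n a ha (cgh n) κ' l' b) hRest hU

end Summit.QuantumFields.BalabanUV.Beta.D1BFx.RoadEndBFxRecutRay

end
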